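import Literature.NumberTheory.Automorphic.UnboundedDenominatorsLevelFieldProofs
import Literature.NumberTheory.Automorphic.UnboundedDenominatorsLambdaFieldProofs
import HarnessLib

/-!
# The unbounded denominators theorem (Calegari–Dimitrov–Tang) — §4.2: the field of ALL level-`Γ(N)` functions, and rationality at level `2`

PROOF-ONLY sequel (no definition, no named fact; D-0026) of `UnboundedDenominatorsLevelFieldProofs.lean`
(level-`Γ(N)` functions `F/Δᵐ`, `F ∈ M_{12m}(Γ(N))`, COMPLEX coefficients: closure under ring
operations and under `SL(2, ℤ)`; the norm trick) and `UnboundedDenominatorsLambdaFieldProofs.lean`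
(`levelField 2 = ℂ⟮λ⟯`; every weight-`12m` form on a group containing `Γ(2)` is
`P(λ) Δᵐ/(λ(1−λ))^{2m}`). Source: F. Calegari, V. Dimitrov, Y. Tang, *The unbounded denominators
conjecture*, J. Amer. Math. Soc. **38** (2025), §4.2 (Lemma 4.2.3: "`M_N` may be identified with the
field of rational functions on the modular curve `Y(N)`", "`M_2 = ℚ(λ)`").

Write `K_N := ℂ(all level-Γ(N) functions) = IntermediateField.adjoin ℂ {F/Δᵐ : F ∈ M_{12m}(Γ(N))}`
(no integrality of `q`-expansions required) — the complex function field of `X(N)`. Then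
`M_N = levelField N ≤ K_N`, and the rationality input `hrat N` of the tree ("every `F/Δᵐ` lies in
`M_N`", Shimura 3.52 in hypothesis form) is the statement `K_N = M_N`. This file proves:

* ★ `algebraMap_modFun_mem_levelField_two` — **`hrat 2` holds unconditionally**: every `F/Δᵐ` with
  `F ∈ M_{12m}(G)`, `G ⊇ Γ(2)`, lies in `levelField 2 = ℂ(λ)` (it is `P(λ)/(λ(1−λ))^{2m}`);
* `exists_div_of_mem_adjoin_lvl`, `levelField_le_adjoin_lvl`, `adjoin_lvl_le_invariantField`,
  `smul_mem_adjoin_lvl` — `K_N` is the field of quotients of level-`Γ(N)` functions, contains `M_N`,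
  is fixed pointwise by `Γ(N)` and is stable under all of `SL(2, ℤ)`;
* ★ `adjoin_lvl_inf_invariantField_Gamma_two_le` — **`K_N^{Γ(2)} ⊆ M_2`**: an element of `K_N` fixed
  by `Γ(2)` lies in `levelField 2` (norm trick down to level `2`, where `hrat` holds).

With the degree bound `[M_N : M_2] ≥ ½[Γ(2) : Γ(N)]` (`UnboundedDenominatorsDegreeLowerBoundProofs`)
and Artin's lemma this yields `K_N = M_N`, i.e. `hrat N`, for even `N` — see the sequel
`UnboundedDenominatorsRationalityProofs.lean`.

## References

* [CalegariDimitrovTang2025] F. Calegari, V. Dimitrov, Y. Tang, The unbounded denominators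
  conjecture, J. Amer. Math. Soc. 38 (2025), no. 3, 627–702; arXiv:2109.09040. §4.2, Lemma 4.2.3.
-/

noncomputable section

namespace Literature.NumberTheory.Automorphic

open scoped MatrixGroups ModularForm Manifold Pointwise
open UpperHalfPlane CongruenceSubgroup Matrix.SpecialLinearGroup ModularGroup
open Literature.NumberTheory.Automorphic.ModularLambda

namespace UnboundedDenominators

/-! ### §1. `hrat` at level `2` -/

/-- ★ **Rationality at level `2` (unconditional): every `F/Δᵐ` with `F ∈ M_{12m}(G)`, `G ⊇ Γ(2)`
of finite index, lies in `M_2 = levelField 2`.** Indeed `F/Δᵐ · (λ(1−λ))^{2m} = P(λ)` for a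
polynomial `P` (`modFun_mul_pow_eq_polynomial`, from the tree's basis theorem for `M_k(Γ(2))`), and
`λ ∈ M_2`. [cite: CalegariDimitrovTang2025, §4.2 ("`M_2 = ℚ(λ)`")] -/
theorem algebraMap_modFun_mem_levelField_two {G : Subgroup SL(2, ℤ)} [G.FiniteIndex]
    (hG : Gamma 2 ≤ G) {m : ℕ} (F : ModularForm (G : Subgroup (GL (Fin 2) ℝ)) (12 * (m : ℤ))) :
    algebraMap hol Mer (modFun m F) ∈ levelField 2 := by
  obtain ⟨L, hL, hmem⟩ := exists_modularLambda_mem_levelField_two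
  obtain ⟨P, -, hP⟩ := modFun_mul_pow_eq_polynomial hG F
  set lam : Mer := algebraMap hol Mer L with hlam
  -- `λ ≠ 0, 1` in `Mer`
  have hL0 : lam ≠ 0 := by
    rw [hlam, map_ne_zero_iff _ algebraMap_hol_injective]
    intro h0
    have := congrArg (fun f : hol ↦ (f : ℍ → ℂ) UpperHalfPlane.I) h0
    simp only [hL, Subalgebra.coe_zero, Pi.zero_apply] at this
    exact modularLambda_ne_zero UpperHalfPlane.I.im_pos this
  have hL1 : 1 - lam ≠ 0 := by
    rw [hlam, ← map_one (algebraMap hol Mer), ← map_sub, map_ne_zero_iff _ algebraMap_hol_injective]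
    intro h0
    have := congrArg (fun f : hol ↦ (f : ℍ → ℂ) UpperHalfPlane.I) h0
    simp only [Subalgebra.coe_sub, Subalgebra.coe_one, Pi.sub_apply, Pi.one_apply, hL,
      Subalgebra.coe_zero, Pi.zero_apply, sub_eq_zero] at this
    exact modularLambda_ne_one UpperHalfPlane.I.im_pos this.symm
  -- the identity `u · (λ(1-λ))^{2m} = P(λ)` in `𝓗`, then in `Mer`
  have hidH : modFun m F * (L ^ (2 * m) * (1 - L) ^ (2 * m)) = Polynomial.aeval L P := by
    apply Subtype.ext
    funext τ
    have hev : ((Polynomial.aeval L P : hol) : ℍ → ℂ) τ = P.eval (modularLambda τ) := by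
      change ((Pi.evalAlgHom ℂ (fun _ : ℍ ↦ ℂ) τ).comp hol.val) (Polynomial.aeval L P) = _
      rw [← Polynomial.aeval_algHom_apply, Polynomial.coe_aeval_eq_eval]
      congr 1
      change (L : ℍ → ℂ) τ = modularLambda τ
      rw [hL]
    rw [hev, ← hP τ]
    simp only [Subalgebra.coe_mul, Subalgebra.coe_pow, Subalgebra.coe_sub, Subalgebra.coe_one,
      Pi.mul_apply, Pi.pow_apply, Pi.sub_apply, Pi.one_apply, hL]
  have hid : algebraMap hol Mer (modFun m F) * (lam ^ (2 * m) * (1 - lam) ^ (2 * m)) =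
      algebraMap hol Mer (Polynomial.aeval L P) := by
    rw [← hidH, map_mul, map_mul, map_pow, map_pow, map_sub, map_one]
  have hne : lam ^ (2 * m) * (1 - lam) ^ (2 * m) ≠ 0 :=
    mul_ne_zero (pow_ne_zero _ hL0) (pow_ne_zero _ hL1)
  rw [eq_div_of_mul_eq hne hid]
  refine div_mem ?_ (mul_mem (pow_mem hmem _) (pow_mem (sub_mem (one_mem _) hmem) _))
  rw [← Polynomial.aeval_algebraMap_apply]
  exact aeval_mem hmem P
where
  /-- Polynomials in an element of an intermediate field stay in it. [folklore] -/
  aeval_mem {x : Mer} (hx : x ∈ levelField 2) (P : Polynomial ℂ) :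
      Polynomial.aeval x P ∈ levelField 2 := by
    have : Polynomial.aeval x P = ((Polynomial.aeval (⟨x, hx⟩ : levelField 2) P : levelField 2) : Mer) := by
      change _ = (levelField 2).val (Polynomial.aeval (⟨x, hx⟩ : levelField 2) P)
      rw [← Polynomial.aeval_algHom_apply]
      rfl
    rw [this]
    exact SetLike.coe_mem _

/-- `hrat` at level `2` in the shape used by `UnboundedDenominatorsLevelFieldProofs`.
[cite: CalegariDimitrovTang2025, §4.2 ("`M_2 = ℚ(λ)`")] -/
theorem hrat_two : ∀ (m : ℕ)
    (F : ModularForm ((Gamma 2 : Subgroup SL(2, ℤ)) : Subgroup (GL (Fin 2) ℝ)) (12 * (m : ℤ))),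
    algebraMap hol Mer (modFun m F) ∈ levelField 2 := fun _ F ↦
  algebraMap_modFun_mem_levelField_two le_rfl F

/-! ### §2. The field `K_N` of all level-`Γ(N)` functions -/

variable {N : ℕ}

/-- `1` is a level-`Γ(N)` function. [folklore] -/
private theorem isLvl_one' :
    ∃ (m : ℕ) (F : ModularForm ((Gamma N : Subgroup SL(2, ℤ)) : Subgroup (GL (Fin 2) ℝ))
      (12 * (m : ℤ))), (1 : Mer) = algebraMap hol Mer (modFun m F) :=
  isLvl_of_mem_levelGens (one_mem_levelGens N)

/-- Finite products of level-`Γ(N)` functions. [folklore] -/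
private theorem isLvl_prod' {ι : Type*} (s : Finset ι) (f : ι → Mer)
    (h : ∀ i ∈ s, ∃ (m : ℕ) (F : ModularForm ((Gamma N : Subgroup SL(2, ℤ)) :
      Subgroup (GL (Fin 2) ℝ)) (12 * (m : ℤ))), f i = algebraMap hol Mer (modFun m F)) :
    ∃ (m : ℕ) (F : ModularForm ((Gamma N : Subgroup SL(2, ℤ)) : Subgroup (GL (Fin 2) ℝ))
      (12 * (m : ℤ))), ∏ i ∈ s, f i = algebraMap hol Mer (modFun m F) := by
  classical
  induction s using Finset.induction_on with
  | empty => simpa using (isLvl_one' (N := N))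
  | insert a s ha ih =>
    rw [Finset.prod_insert ha]
    exact isLvl_mul (h a (Finset.mem_insert_self a s))
      (ih fun i hi ↦ h i (Finset.mem_insert_of_mem hi))

/-- Every element of the `ℂ`-algebra generated by the level-`Γ(N)` functions is a level-`Γ(N)`
function (they form a `ℂ`-subalgebra). [cite: CalegariDimitrovTang2025, proof of Lemma 4.2.3] -/
theorem isLvl_of_mem_algebraAdjoin {x : Mer}
    (hx : x ∈ Algebra.adjoin ℂ {y : Mer | ∃ (m : ℕ) (F : ModularForm ((Gamma N : Subgroup SL(2, ℤ)) :
      Subgroup (GL (Fin 2) ℝ)) (12 * (m : ℤ))), y = algebraMap hol Mer (modFun m F)}) :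
    ∃ (m : ℕ) (F : ModularForm ((Gamma N : Subgroup SL(2, ℤ)) : Subgroup (GL (Fin 2) ℝ))
      (12 * (m : ℤ))), x = algebraMap hol Mer (modFun m F) := by
  induction hx using Algebra.adjoin_induction with
  | mem y hy => exact hy
  | algebraMap c =>
    rw [Algebra.algebraMap_eq_smul_one]
    exact isLvl_smul_const c isLvl_one'
  | add x y _ _ hx hy => exact isLvl_add hx hy
  | mul x y _ _ hx hy => exact isLvl_mul hx hy

/-- **`K_N` is the field of quotients of level-`Γ(N)` functions**: every element of
`K_N = ℂ(all F/Δᵐ, F ∈ M_{12m}(Γ(N)))` is `a/b` with `a, b` level-`Γ(N)` functions.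
[cite: CalegariDimitrovTang2025, Lemma 4.2.3] -/
theorem exists_div_of_mem_adjoin_lvl {x : Mer}
    (hx : x ∈ IntermediateField.adjoin ℂ {y : Mer | ∃ (m : ℕ)
      (F : ModularForm ((Gamma N : Subgroup SL(2, ℤ)) : Subgroup (GL (Fin 2) ℝ)) (12 * (m : ℤ))),
      y = algebraMap hol Mer (modFun m F)}) :
    ∃ a b : Mer,
      (∃ (m : ℕ) (F : ModularForm ((Gamma N : Subgroup SL(2, ℤ)) : Subgroup (GL (Fin 2) ℝ))
        (12 * (m : ℤ))), a = algebraMap hol Mer (modFun m F)) ∧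
      (∃ (m : ℕ) (F : ModularForm ((Gamma N : Subgroup SL(2, ℤ)) : Subgroup (GL (Fin 2) ℝ))
        (12 * (m : ℤ))), b = algebraMap hol Mer (modFun m F)) ∧ x = a / b := by
  obtain ⟨a, ha, b, hb, rfl⟩ := IntermediateField.mem_adjoin_iff_div.mp hx
  exact ⟨a, b, isLvl_of_mem_algebraAdjoin ha, isLvl_of_mem_algebraAdjoin hb, rfl⟩

/-- **`M_N ⊆ K_N`**: the integral generators of `M_N` are level-`Γ(N)` functions.
[cite: CalegariDimitrovTang2025, Lemma 4.2.3] -/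
theorem levelField_le_adjoin_lvl (N : ℕ) :
    levelField N ≤ IntermediateField.adjoin ℂ {y : Mer | ∃ (m : ℕ)
      (F : ModularForm ((Gamma N : Subgroup SL(2, ℤ)) : Subgroup (GL (Fin 2) ℝ)) (12 * (m : ℤ))),
      y = algebraMap hol Mer (modFun m F)} :=
  IntermediateField.adjoin.mono ℂ _ _ fun _ hu ↦ isLvl_of_mem_levelGens hu

/-- **`K_N` is fixed pointwise by `Γ(N)`.** [cite: CalegariDimitrovTang2025, Definition 4.2.1] -/
theorem adjoin_lvl_le_invariantField (N : ℕ) :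
    IntermediateField.adjoin ℂ {y : Mer | ∃ (m : ℕ)
      (F : ModularForm ((Gamma N : Subgroup SL(2, ℤ)) : Subgroup (GL (Fin 2) ℝ)) (12 * (m : ℤ))),
      y = algebraMap hol Mer (modFun m F)} ≤ invariantField (Gamma N) :=
  IntermediateField.adjoin_le_iff.mpr fun _ hy ↦ mem_invariantField_of_isLvl hy

/-- **`K_N` is stable under all of `SL(2, ℤ)`** (the function field of `X(N)` is Galois over that
of `X(1)`). [cite: CalegariDimitrovTang2025, Lemma 4.2.3] -/
theorem smul_mem_adjoin_lvl (γ : SL(2, ℤ)) {x : Mer}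
    (hx : x ∈ IntermediateField.adjoin ℂ {y : Mer | ∃ (m : ℕ)
      (F : ModularForm ((Gamma N : Subgroup SL(2, ℤ)) : Subgroup (GL (Fin 2) ℝ)) (12 * (m : ℤ))),
      y = algebraMap hol Mer (modFun m F)}) :
    γ • x ∈ IntermediateField.adjoin ℂ {y : Mer | ∃ (m : ℕ)
      (F : ModularForm ((Gamma N : Subgroup SL(2, ℤ)) : Subgroup (GL (Fin 2) ℝ)) (12 * (m : ℤ))),
      y = algebraMap hol Mer (modFun m F)} := by
  obtain ⟨a, b, ha, hb, rfl⟩ := exists_div_of_mem_adjoin_lvl hx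
  rw [div_eq_mul_inv, smul_mul', smul_inv'', ← div_eq_mul_inv]
  exact div_mem (IntermediateField.subset_adjoin ℂ _ (isLvl_smul γ ha))
    (IntermediateField.subset_adjoin ℂ _ (isLvl_smul γ hb))

/-! ### §3. `K_N^{Γ(2)} ⊆ M_2` -/

/-- ★ **An element of `K_N` fixed by `Γ(2)` lies in `M_2 = levelField 2`** [cite:
CalegariDimitrovTang2025, Lemma 4.2.3]. Norm trick (as in
`levelField_inf_invariantField_Gamma_le_levelField`): `x = a/b` with `a, b` level-`Γ(N)` functions;
`b̃ = ∏_{σ ∈ SL₂(ℤ)/Γ(N)} σ • b` and `x b̃` are level-`Γ(N)` functions fixed by `Γ(2)`, hence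
(bundling on `Γ(2)`) of the form `F/Δᵐ` with `F ∈ M_{12m}(Γ(2))`, which lie in `M_2` by
`hrat_two`; and `x = (x b̃)/b̃`. -/
theorem adjoin_lvl_inf_invariantField_Gamma_two_le (hN : N ≠ 0) :
    IntermediateField.adjoin ℂ {y : Mer | ∃ (m : ℕ)
      (F : ModularForm ((Gamma N : Subgroup SL(2, ℤ)) : Subgroup (GL (Fin 2) ℝ)) (12 * (m : ℤ))),
      y = algebraMap hol Mer (modFun m F)} ⊓ invariantField (Gamma 2) ≤ levelField 2 := by
  classical
  haveI : NeZero N := ⟨hN⟩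
  intro x hx
  obtain ⟨hxK, hxI⟩ := IntermediateField.mem_inf.mp hx
  obtain ⟨a, b, haL, hbL, rfl⟩ := exists_div_of_mem_adjoin_lvl hxK
  by_cases hb0 : b = 0
  · rw [hb0, div_zero]
    exact zero_mem _
  -- the norm of `b` over `SL(2, ℤ)/Γ(N)`
  let Q := SL(2, ℤ) ⧸ Gamma N
  haveI : Fintype Q := Fintype.ofFinite Q
  let nb : Q → Mer := fun q ↦ (q.out : SL(2, ℤ)) • b
  have hbfix : ∀ h ∈ Gamma N, h • b = b := fun h hh ↦
    mem_invariantField_iff.mp (mem_invariantField_of_isLvl hbL) h hh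
  have hnb : ∀ g : SL(2, ℤ), nb (g : Q) = g • b := fun g ↦ by
    obtain ⟨h, hh⟩ := QuotientGroup.mk_out_eq_mul (Gamma N) g
    change ((g : Q).out : SL(2, ℤ)) • b = g • b
    rw [hh, mul_smul, hbfix h h.2]
  have hnb_lvl : ∀ q : Q, ∃ (m : ℕ) (F : ModularForm ((Gamma N : Subgroup SL(2, ℤ)) :
      Subgroup (GL (Fin 2) ℝ)) (12 * (m : ℤ))), nb q = algebraMap hol Mer (modFun m F) :=
    fun q ↦ isLvl_smul _ hbL
  let bt : Mer := ∏ q : Q, nb q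
  have hbt_fix : ∀ γ : SL(2, ℤ), γ • bt = bt := fun γ ↦ by
    simp only [bt, Finset.smul_prod']
    refine Fintype.prod_equiv (MulAction.toPerm γ) _ _ fun q ↦ ?_
    change γ • ((q.out : SL(2, ℤ)) • b) = nb (γ • q)
    rw [← mul_smul, ← hnb, ← MulAction.Quotient.coe_smul_out, smul_eq_mul]
  have hbt_lvl := isLvl_prod' (Finset.univ : Finset Q) nb fun q _ ↦ hnb_lvl q
  have hbt_ne : bt ≠ 0 := Finset.prod_ne_zero_iff.mpr fun q _ ↦ by
    change (q.out : SL(2, ℤ)) • b ≠ 0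
    rwa [ne_eq, smul_eq_zero_iff_eq]
  -- `x · b̃` is a level-`Γ(N)` function: `x b̃ = a · ∏_{q ≠ 1} nb q`
  have hnb1 : nb ((1 : SL(2, ℤ)) : Q) = b := by
    rw [hnb, one_smul]
  have hxbt_lvl : ∃ (m : ℕ) (F : ModularForm ((Gamma N : Subgroup SL(2, ℤ)) :
      Subgroup (GL (Fin 2) ℝ)) (12 * (m : ℤ))), a / b * bt = algebraMap hol Mer (modFun m F) := by
    have heq : a / b * bt = a * ∏ q ∈ Finset.univ.erase ((1 : SL(2, ℤ)) : Q), nb q := by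
      have hsplit : bt = b * ∏ q ∈ Finset.univ.erase ((1 : SL(2, ℤ)) : Q), nb q := by
        rw [← hnb1]
        exact (Finset.mul_prod_erase Finset.univ nb (Finset.mem_univ _)).symm
      rw [hsplit, ← mul_assoc, div_mul_cancel₀ a hb0]
    rw [heq]
    exact isLvl_mul haL (isLvl_prod' _ nb fun q _ ↦ hnb_lvl q)
  have hxbt_fix : ∀ γ ∈ Gamma 2, γ • (a / b * bt) = a / b * bt := fun γ hγ ↦ by
    rw [smul_mul', mem_invariantField_iff.mp hxI γ hγ, hbt_fix]
  -- conclude with `hrat 2`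
  have h1 : a / b * bt ∈ levelField 2 :=
    mem_levelField_of_isLvl_of_forall_smul_eq two_ne_zero hN hrat_two hxbt_lvl hxbt_fix
  have h2 : bt ∈ levelField 2 :=
    mem_levelField_of_isLvl_of_forall_smul_eq two_ne_zero hN hrat_two hbt_lvl fun γ _ ↦ hbt_fix γ
  rw [show a / b = a / b * bt / bt from (mul_div_cancel_right₀ _ hbt_ne).symm]
  exact div_mem h1 h2

end UnboundedDenominators

end Literature.NumberTheory.Automorphic

end
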